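import Summits.NavierStokesRegularity.NavierStokesRegularity.Theorems.FilamentSkeletonRssSkeletonJ1RLiaPartnerWindow
import Summits.NavierStokesRegularity.NavierStokesRegularity.Theorems.FilamentSkeletonRssSkeletonJ1RLiaSelfEnvelope
import Summits.NavierStokesRegularity.NavierStokesRegularity.Theorems.FilamentSkeletonRssSkeletonJ1RLiaShooting
import Summits.NavierStokesRegularity.NavierStokesRegularity.Theorems.FilamentSkeletonRssSkeletonEquilibriumKernelIntegrable

/-!
# Route `FilamentSkeletonRss` · crux `SkeletonJ1R` (stmt-NavierStokesRegularity-23610) · stub F2 `LiaDefectL` — PARTNER-STRAND BRICK (P2):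
# the ambient-vs-actual mismatch of ONE PARTNER OF THE LIA REFERENCE at an arbitrary point (brick P1 fed with the reference envelopes)

Lead `ns-fsr-lead-23610` (g2), line `streamline_kantorovich_R` (skeleton of record v5).  Helper file `--supports stmt-NavierStokesRegularity-23610`;
route-independent (no `Theses` import).

`IsLiaReference.partnerStrand_sub_le`: for THE local-induction reference `x`, a partner `k`, the linear curvature envelope `‖x_k″σ‖ ≤ ε₀ + ε₁|σ|`
(brick E2) and a global tilt `‖x_k′ − t_k‖ ≤ θ₁ ≤ 1/10`, at every point `y` at perpendicular distance `≥ a > 0` from the datum line `k` with foot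
parameter `s = ⟪y − w_k, t_k⟫` and `10θ₁|s| ≤ a`, and every `L₀ > 0`, kernel core `e ≠ 0`:
`‖∫ K_e(‖y−x_kσ‖)•(x_k′σ × (y−x_kσ)) dσ − ∫ K_e(‖y−L_kσ‖)•(t_k × (y−L_kσ)) dσ‖ ≤ 2Lk·A₀ + πA₁/a + 416πθ₁/Lk`
with `Lk = 2|s| + L₀`, `A₀ = 51ε₀/a + 104ε₁`, `A₁ = 50ε₀s²/a + 100ε₁|s|³/a + 2ε₀|s| + 4ε₁s²` (brick P1 with `d₂ = t₁ = ε₀`, `d₃ = t₂ = ε₁`: the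
partner is shot from the common waist `x_k 0 = w_k`, `x_k′0 = t_k`, so its displacement from the datum line is the Taylor remainder and its tilt the
tangent increment, both integrated from the envelope; integrability of both strands from the landed `stub_kernelIntegrable` / `lineBiotSavart_core`).
HONEST FRAMING: MODEL rung, ∃-side helper lemmas toward stub F2 of a HYPOTHETICAL filament-type blow-up skeleton; F2 and the crux 23610 stay OPEN;
nothing here bears on Navier–Stokes regularity, which is NOT proved. [folklore]
-/

-- `dupNamespace` off: the module name repeats `NavierStokesRegularity` by the tree's `Summits/<S>/<S>/Theorems` layout (same as every sibling file).
set_option linter.dupNamespace false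

noncomputable section

namespace Summit.NavierStokesRegularity.NavierStokesRegularity.Theorems.SkeletonJ1RFrame

open Set Function Filter Real Topology MeasureTheory
open Literature.Analysis.FluidPDE
open Summit.NavierStokesRegularity.NavierStokesRegularity.Theorems.SkeletonJ1RMismatchTools (norm_sub_line_sq norm_integral_kernelCross_sub_le_of_envelopes)
open Summit.NavierStokesRegularity.NavierStokesRegularity.Theorems.SkeletonJ1RLiaSelf (norm_deriv_sub_deriv_le_on norm_taylorTwo_le_of_curvature
  norm_taylorTwo_le_of_osc abs_le_of_mem_uIcc)
open Summit.NavierStokesRegularity.NavierStokesRegularity.Theorems.SkeletonJ1RSlipTools (chord_arc_of_osc)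
open Summit.NavierStokesRegularity.NavierStokesRegularity.Theorems.SkeletonEquilibrium.Sketch (stub_kernelIntegrable)
open scoped InnerProductSpace BigOperators

variable {N : ℕ} {Γ Rb : ℝ} {p t : Fin N → EuclideanSpace ℝ (Fin 3)} {γ : Fin N → ℝ} {α : ℝ} {s₀ : Fin N → ℝ}
  {x : Fin N → ℝ → EuclideanSpace ℝ (Fin 3)}

/-- **One partner of the LIA reference against its datum line, at an arbitrary point** (see the module docstring). [folklore] -/
theorem IsLiaReference.partnerStrand_sub_le (hx : IsLiaReference Γ Rb p t γ α s₀ x) (ht : ∀ k, ‖t k‖ = 1) (k : Fin N)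
    {ε₀ ε₁ θ₁ : ℝ} (hε₀ : 0 ≤ ε₀) (hε₁ : 0 ≤ ε₁) (henv : ∀ σ, ‖deriv (deriv (x k)) σ‖ ≤ ε₀ + ε₁ * |σ|) (hθ₁0 : 0 ≤ θ₁)
    (hθ₁ : θ₁ ≤ 1 / 10) (htilt : ∀ σ, ‖deriv (x k) σ - t k‖ ≤ θ₁) {e : ℝ} (he : e ≠ 0) (y : EuclideanSpace ℝ (Fin 3)) {a L₀ : ℝ}
    (ha : 0 < a) (hL₀ : 0 < L₀) (hay : a ^ 2 ≤ ‖y - waistPt Γ p t s₀ k‖ ^ 2 - (inner ℝ (y - waistPt Γ p t s₀ k) (t k)) ^ 2)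
    (hθs : 10 * θ₁ * |inner ℝ (y - waistPt Γ p t s₀ k) (t k)| ≤ a) :
    ‖(∫ σ : ℝ, ((‖y - x k σ‖ ^ 2 + e ^ 2) ^ (3 / 2 : ℝ))⁻¹ • cross (deriv (x k) σ) (y - x k σ)) -
        ∫ σ : ℝ, ((‖y - datumLine Γ p t s₀ k σ‖ ^ 2 + e ^ 2) ^ (3 / 2 : ℝ))⁻¹ • cross (t k) (y - datumLine Γ p t s₀ k σ)‖ ≤
      2 * (2 * |inner ℝ (y - waistPt Γ p t s₀ k) (t k)| + L₀) * (50 * ε₀ / a + 100 * ε₁ + ε₀ / a + 4 * ε₁) +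
        (50 * ε₀ * (inner ℝ (y - waistPt Γ p t s₀ k) (t k)) ^ 2 / a + 100 * ε₁ * |inner ℝ (y - waistPt Γ p t s₀ k) (t k)| ^ 3 / a +
          2 * ε₀ * |inner ℝ (y - waistPt Γ p t s₀ k) (t k)| + 4 * ε₁ * (inner ℝ (y - waistPt Γ p t s₀ k) (t k)) ^ 2) * (Real.pi / a) +
        416 * θ₁ * (Real.pi / (2 * |inner ℝ (y - waistPt Γ p t s₀ k) (t k)| + L₀)) := by
  obtain ⟨hC2, hunit, h0, h0', -⟩ := hx k
  set w := waistPt Γ p t s₀ k with hw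
  set s : ℝ := inner ℝ (y - w) (t k) with hs
  set L : ℝ → EuclideanSpace ℝ (Fin 3) := datumLine Γ p t s₀ k with hL
  have hLσ : ∀ σ, L σ = w + σ • t k := fun σ => rfl
  have hLx : ∀ σ, L σ = x k 0 + σ • deriv (x k) 0 := fun σ => by rw [hLσ, h0, h0']
  have hLk : 0 < 2 * |s| + L₀ := by positivity
  have hLs : 2 * |s| ≤ 2 * |s| + L₀ := by linarith
  -- the line hypothesis (equality for a straight line)
  have hline : ∀ σ, a ^ 2 + (σ - s) ^ 2 ≤ ‖y - L σ‖ ^ 2 := fun σ => by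
    rw [hLσ, norm_sub_line_sq y w (t k) (ht k) σ]; linarith
  -- envelopes of the partner, shot from the common waist
  have hseg : ∀ σ, ∀ q ∈ uIcc 0 σ, ‖deriv (deriv (x k)) q‖ ≤ ε₀ + ε₁ * |σ| := fun σ q hq => by
    have h := (abs_le_of_mem_uIcc hq).2
    rw [abs_zero, zero_add, sub_zero] at h
    exact (henv q).trans (by nlinarith)
  have hdisp : ∀ σ, ‖x k σ - L σ‖ ≤ ε₀ * σ ^ 2 + ε₁ * |σ| ^ 3 := fun σ => by
    have h := norm_taylorTwo_le_of_curvature hC2 (hseg σ)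
    rw [sub_zero] at h
    rw [hLx, ← sub_sub]
    calc ‖x k σ - x k 0 - σ • deriv (x k) 0‖ ≤ (ε₀ + ε₁ * |σ|) * σ ^ 2 := h
      _ = ε₀ * σ ^ 2 + ε₁ * |σ| ^ 3 := by rw [← sq_abs σ]; ring
  have hdispθ : ∀ σ, ‖x k σ - L σ‖ ≤ θ₁ * |σ| := fun σ => by
    have h := norm_taylorTwo_le_of_osc hC2 (τ := 0) (σ := σ) (θ := θ₁) fun q _ => by rw [h0']; exact htilt q
    rw [sub_zero] at h
    rw [hLx, ← sub_sub]; exact h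
  have htilt' : ∀ σ, ‖deriv (x k) σ - t k‖ ≤ ε₀ * |σ| + ε₁ * σ ^ 2 := fun σ => by
    have h := norm_deriv_sub_deriv_le_on hC2 (hseg σ)
    rw [sub_zero, h0'] at h
    calc ‖deriv (x k) σ - t k‖ ≤ (ε₀ + ε₁ * |σ|) * |σ| := h
      _ = ε₀ * |σ| + ε₁ * σ ^ 2 := by rw [← sq_abs σ]; ring
  -- smallness of the displacement against the distance
  have hsmall : ∀ σ, ‖x k σ - L σ‖ ≤ ‖y - L σ‖ / 5 := fun σ => by
    have hr2 := hline σ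
    have hr0 : 0 ≤ ‖y - L σ‖ := norm_nonneg _
    have har : a ≤ ‖y - L σ‖ := by nlinarith [sq_nonneg (σ - s), sq_nonneg (‖y - L σ‖ - a)]
    have hus : |σ - s| ≤ ‖y - L σ‖ := by
      have : |σ - s| ^ 2 ≤ ‖y - L σ‖ ^ 2 := by rw [sq_abs]; nlinarith
      nlinarith [abs_nonneg (σ - s), sq_nonneg (‖y - L σ‖ - |σ - s|)]
    have hσle : |σ| ≤ |σ - s| + |s| := by
      calc |σ| = |(σ - s) + s| := by rw [sub_add_cancel]
        _ ≤ |σ - s| + |s| := abs_add_le _ _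
    calc ‖x k σ - L σ‖ ≤ θ₁ * |σ| := hdispθ σ
      _ ≤ θ₁ * |σ - s| + θ₁ * |s| := by nlinarith
      _ ≤ ‖y - L σ‖ / 10 + a / 10 := by nlinarith
      _ ≤ ‖y - L σ‖ / 5 := by linarith
  -- integrability of both strands
  have hosc : ∀ u v, ‖deriv (x k) u - deriv (x k) v‖ ≤ 2 * θ₁ := fun u v => by
    calc ‖deriv (x k) u - deriv (x k) v‖ = ‖(deriv (x k) u - t k) - (deriv (x k) v - t k)‖ := by congr 1; abel
      _ ≤ ‖deriv (x k) u - t k‖ + ‖deriv (x k) v - t k‖ := norm_sub_le _ _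
      _ ≤ 2 * θ₁ := by linarith [htilt u, htilt v]
  have hgrow : ∀ u, (1 / 2 : ℝ) * |u| - ‖w‖ ≤ ‖x k u‖ := fun u => by
    have h := chord_arc_of_osc (hC2.of_le (by norm_num)) hunit hosc u 0
    rw [sub_zero, h0] at h
    have h2 : (1 / 2 : ℝ) * |u| ≤ (1 - (2 * θ₁) ^ 2 / 2) * |u| := mul_le_mul_of_nonneg_right (by nlinarith) (abs_nonneg u)
    have h3 : ‖x k u - w‖ ≤ ‖x k u‖ + ‖w‖ := norm_sub_le _ _
    linarith
  have hintA : Integrable fun σ : ℝ => ((‖y - x k σ‖ ^ 2 + e ^ 2) ^ (3 / 2 : ℝ))⁻¹ • cross (deriv (x k) σ) (y - x k σ) :=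
    stub_kernelIntegrable e (1 / 2) ‖w‖ (x k) he (by norm_num) (hC2.of_le (by norm_num)) (fun u => (hunit u).le) hgrow y
  have hintB : Integrable fun σ : ℝ => ((‖y - L σ‖ ^ 2 + e ^ 2) ^ (3 / 2 : ℝ))⁻¹ • cross (t k) (y - L σ) := by
    have h := (lineBiotSavart_core (a := e ^ 2) (by positivity) w (t k) y (ht k)).1
    simpa only [hLσ] using h
  -- brick P1
  have h := norm_integral_kernelCross_sub_le_of_envelopes e ha hε₀ hε₁ hε₀ hε₁ hθ₁0 (ht k) hLk hLs hline hdisp hdispθ htilt' htilt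
    hsmall (fun σ => (hunit σ).le) hintA hintB
  rw [← integral_sub hintA hintB]
  simpa only [hL] using h

end Summit.NavierStokesRegularity.NavierStokesRegularity.Theorems.SkeletonJ1RFrame

end
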